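import Literature.AlgebraicGeometry.Motives.UniversalHypersurfaceFamily
import HarnessLib

/-!
# The universal family of smooth hypersurfaces is smooth of relative dimension `n`

For a field `k`, `n d : ℕ` with `d ≥ 1`, the universal smooth hypersurface
`π = familyHom k n d : 𝒴_U → U` of `Motives/UniversalHypersurfaceFamily` (Voisin, *Hodge Theory II*,
§6.2.1) is smooth of relative dimension `n` (Mathlib `SmoothOfRelativeDimension`):
`smoothOfRelativeDimension_familyHom`. This is the Jacobian criterion in families (Hartshorne,
*Algebraic Geometry*, III Thm. 10.2 with I Ex. 5.8), proved exactly as the fibrewise statement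
`Motives/SmoothHypersurfaceScheme.smoothOfRelativeDimension_hypersurface_hom`, with the base field
replaced by the coefficient ring `R = k[a_m]`:

* over `U` the charts `D₊(xᵢ · ∂F/∂xⱼ)` cover `𝒴_U` (Euler cover,
  `UniversalHypersurface.exists_mem_basicOpen`);
* on such a chart the reduced structure on `V₊(F)` has ideal `rad(f) = (f)`, `f = F(xᵢ := 1)` read
  in `S = (R[x]_{xᵢ∂ⱼF})₀ = R[y][1/∂ⱼf]` (`ideal_chartOpen_eq`), because `S/(f)` is standard smooth
  of relative dimension `n` over `R` (`Motives/HypersurfaceJacobianPresentation`), hence standard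
  smooth over the field `k` (composition with the polynomial ring `R`, Mathlib
  `IsStandardSmoothOfRelativeDimension.trans`), hence reduced (`isReduced_chart`, Stacks 056T via
  `Motives/GoodReductionSpecialFibreProofs`);
* smoothness is Zariski-local at the source and stable under restriction to `U`.

Appendix (theorems about the definitions `jacobianIdeal`, `orbitTangent` of the family file):
`exists_orbitTangent_eq` — the degree-`d` piece `J_F^d` of the Jacobian ideal consists exactly of
the orbit tangent vectors `Σᵢ Aᵢ ∂ᵢF` (Voisin II, Remark 6.16, "`T_{O_f,f} = J_f^d`", the kernel of
the Kodaira–Spencer map of Lemma 6.15).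

## References

* R. Hartshorne, *Algebraic Geometry* (1977): I Ex. 5.8, II Prop. 2.5, III Thm. 10.2. [Hartshorne1977]
* C. Voisin, *Hodge Theory and Complex Algebraic Geometry II* (2003), §6.2.1. [VoisinHodgeII2003]
* The Stacks project, Tag 056T. [StacksProject]
-/

noncomputable section

open CategoryTheory AlgebraicGeometry MvPolynomial HomogeneousLocalization TopologicalSpace Limits

universe u

namespace Literature.AlgebraicGeometry.Motives.UniversalHypersurface

variable (k : Type u) [Field k] (n d : ℕ)

attribute [local instance] MvPolynomial.gradedAlgebra ProjBaseChange.algebraBase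
  ProjBaseChange.isScalarTower_localization

/-- graded pieces of `R[x₀, …, x_{n+1}]` -/
local notation "𝒜" R => MvPolynomial.homogeneousSubmodule (Fin (n + 2)) R

/-! ### The charts are standard smooth over `R`, hence reduced -/

/-- The coefficient ring `k[a_m]` is standard smooth over `k` of relative dimension the number of
coefficients (`Motives/VarietiesProjectiveSpaceProofs`, reindexed). [folklore] -/
theorem isStandardSmoothOfRelativeDimension_coeffRing :
    Algebra.IsStandardSmoothOfRelativeDimension (Fintype.card (DegIndex n d)) k
      (CoeffRing k n d) :=
  haveI := ProjectiveSpace.isStandardSmoothOfRelativeDimension_mvPolynomial_fin k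
    (Fintype.card (DegIndex n d))
  Algebra.IsStandardSmoothOfRelativeDimension.of_algEquiv (Fintype.card (DegIndex n d))
    (MvPolynomial.renameEquiv k (Fintype.equivFin (DegIndex n d)).symm)

section Chart

variable (i : Fin (n + 2)) (j : Fin (n + 1))

local notation "S" => ChartRing k n d i j

local notation "fS" => chartEquation k n d i j

/-- On `D₊(xᵢ h)`, `h = ∂F/∂x_{i.succAbove j}`, the ideal of the reduced structure on `V₊(F) ∩ D₊(xᵢh)`,
read in `S` through `S ≅ Γ(D₊(xᵢh))`, is the **radical of `(f)`**, `f = F(xᵢ := 1)` (Hartshorne II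
Example 3.2.6 with I Ex. 5.8(b); `ProjSubscheme.awayι_mul_preimage_zeroLocus`). [folklore] -/
theorem ideal_chartOpen_eq_map_radical (hd : 0 < d) :
    (idealSheaf k n d).ideal (chartOpen k n d i j) =
      Ideal.map (Proj.awayToSection (𝒜 (CoeffRing k n d))
        (X i * pderiv (i.succAbove j) (universalForm k n d))).hom
        (Ideal.span {fS}).radical := by
  rw [idealSheaf, ProjSubscheme.vanishingIdeal_ideal_affineBasicOpen]
  congr 1
  change PrimeSpectrum.vanishingIdeal
    (_ ⁻¹' ProjectiveSpectrum.zeroLocus _ {universalForm k n d}) = _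
  refine (congrArg PrimeSpectrum.vanishingIdeal
    (ProjSubscheme.awayι_mul_preimage_zeroLocus (𝒜 (CoeffRing k n d)) (ProjectiveSpace.X_mem i)
      Nat.one_pos (pderiv_mem k n d (i.succAbove j)) rfl
      (isHomogeneous_universalForm k n d) hd)).trans ?_
  rw [← SmoothHypersurface.chartMap_dehomogenize (CoeffRing k n d) i _ (universalForm k n d)
      (isHomogeneous_universalForm k n d), ← PrimeSpectrum.zeroLocus_span,
    PrimeSpectrum.vanishingIdeal_zeroLocus_eq_radical]

/-- **Jacobian criterion on the chart**: `S/(f)` is standard smooth of relative dimension `n` over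
`R` (`Motives/HypersurfaceJacobianPresentation`, as `S = R[y][1/∂ⱼf]`). [cite: Hartshorne1977, I Ex. 5.8 and III Thm. 10.2] -/
theorem isStandardSmoothOfRelativeDimension_chart :
    Algebra.IsStandardSmoothOfRelativeDimension n (CoeffRing k n d) (S ⧸ Ideal.span {fS}) := by
  letI : Algebra (MvPolynomial (Fin (n + 1)) (CoeffRing k n d)) S :=
    (SmoothHypersurface.chartMap (CoeffRing k n d) i
      (pderiv_mem k n d (i.succAbove j))).toRingHom.toAlgebra
  haveI : IsScalarTower (CoeffRing k n d) (MvPolynomial (Fin (n + 1)) (CoeffRing k n d)) S :=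
    IsScalarTower.of_algebraMap_eq fun r =>
      ((SmoothHypersurface.chartMap (CoeffRing k n d) i
        (pderiv_mem k n d (i.succAbove j))).commutes r).symm
  haveI : IsLocalization.Away (pderiv j (ProjectiveSpace.dehomogenize (CoeffRing k n d) i
      (universalForm k n d))) S := by
    rw [ProjectiveSpace.pderiv_dehomogenize]
    exact SmoothHypersurface.isLocalization_chartMap (CoeffRing k n d) i
      (pderiv_mem k n d (i.succAbove j))
  exact SmoothHypersurface.isStandardSmoothOfRelativeDimension_quotient
    (ProjectiveSpace.dehomogenize (CoeffRing k n d) i (universalForm k n d)) j S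

/-- `S/(f)` is standard smooth over the FIELD `k` (composition with the polynomial coefficient
ring), hence reduced (Stacks 056T). [cite: StacksProject, Tag 056T] -/
theorem isReduced_chart : IsReduced (S ⧸ Ideal.span {fS}) := by
  letI : Algebra k (S ⧸ Ideal.span {fS}) :=
    ((algebraMap (CoeffRing k n d) (S ⧸ Ideal.span {fS})).comp
      (algebraMap k (CoeffRing k n d))).toAlgebra
  haveI : IsScalarTower k (CoeffRing k n d) (S ⧸ Ideal.span {fS}) :=
    IsScalarTower.of_algebraMap_eq fun _ => rfl
  haveI := isStandardSmoothOfRelativeDimension_coeffRing k n d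
  haveI := isStandardSmoothOfRelativeDimension_chart k n d i j
  haveI := Algebra.IsStandardSmoothOfRelativeDimension.trans (n := Fintype.card (DegIndex n d))
    (m := n) k (CoeffRing k n d) (S ⧸ Ideal.span {fS})
  exact isReduced_of_isStandardSmoothOfRelativeDimension k (n + Fintype.card (DegIndex n d))

/-- Hence `(f)` is a radical ideal of `S`. [folklore] -/
theorem radical_span_chart_eq : (Ideal.span {fS}).radical = Ideal.span {fS} :=
  haveI := isReduced_chart k n d i j
  Ideal.radical_eq_iff.mpr ((Ideal.isRadical_iff_quotient_reduced _).mpr this)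

/-- **`𝒴` on the chart is `f = 0`**: the ideal of the reduced structure on `V₊(F) ∩ D₊(xᵢh)` is
`(f)` itself (through `S ≅ Γ(D₊(xᵢh))`). [folklore] -/
theorem ideal_chartOpen_eq (hd : 0 < d) :
    (idealSheaf k n d).ideal (chartOpen k n d i j) =
      Ideal.map (Proj.awayToSection (𝒜 (CoeffRing k n d))
        (X i * pderiv (i.succAbove j) (universalForm k n d))).hom (Ideal.span {fS}) := by
  rw [ideal_chartOpen_eq_map_radical k n d i j hd, radical_span_chart_eq k n d i j]

/-- The chart `Spec (Γ(D₊(xᵢh))/𝓘) → 𝒴 → Spec R` is `Spec` of `chartRingHom`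
(`ProjSubscheme.subschemePiece_ι_toSpecZero`). [folklore] -/
theorem subschemePiece_hom :
    ProjSubscheme.subschemePiece (idealSheaf k n d) (chartOpen k n d i j) ≫ totalToSpec k n d =
      Spec.map (CommRingCat.ofHom (chartRingHom k n d i j)) := by
  change ProjSubscheme.subschemePiece (idealSheaf k n d) (chartOpen k n d i j) ≫
    (idealSheaf k n d).subschemeι ≫ Proj.toSpecZero (𝒜 (CoeffRing k n d)) ≫
      Spec.map (CommRingCat.ofHom (algebraMap (CoeffRing k n d) _)) = _
  rw [reassoc_of% ProjSubscheme.subschemePiece_ι_toSpecZero (𝒜 (CoeffRing k n d))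
    (X i * pderiv (i.succAbove j) (universalForm k n d))
    (X_mul_pderiv_mem k n d i j) (SmoothHypersurface.one_add_pos d) (idealSheaf k n d),
    ← Spec.map_comp]
  rfl

/-- `chartRingHom` is, up to `S/(f) ≅ Γ(D₊(xᵢh))/𝓘`, the structure map `R → S/(f)`; hence it is
standard smooth of relative dimension `n`. [cite: Hartshorne1977, I Ex. 5.8 and III Thm. 10.2] -/
theorem isStandardSmoothOfRelativeDimension_chartRingHom (hd : 0 < d) :
    (chartRingHom k n d i j).IsStandardSmoothOfRelativeDimension n := by
  let e : S ≃+* Γ(projSp n (CoeffRing k n d),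
      (chartOpen k n d i j : (projSp n (CoeffRing k n d)).Opens)) :=
    (Proj.basicOpenIsoAway (𝒜 (CoeffRing k n d))
      (X i * pderiv (i.succAbove j) (universalForm k n d)) (X_mul_pderiv_mem k n d i j)
      (SmoothHypersurface.one_add_pos d)).commRingCatIsoToRingEquiv
  have hIJ : (idealSheaf k n d).ideal (chartOpen k n d i j) =
      Ideal.map (e : S →+* _) (Ideal.span {fS}) := by
    rw [ideal_chartOpen_eq k n d i j hd]
    rfl
  let E := Ideal.quotientEquiv (Ideal.span {fS}) ((idealSheaf k n d).ideal (chartOpen k n d i j))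
    e hIJ
  haveI := isStandardSmoothOfRelativeDimension_chart k n d i j
  have hQ : (algebraMap (CoeffRing k n d) (S ⧸ Ideal.span {fS})).IsStandardSmoothOfRelativeDimension n :=
    (RingHom.isStandardSmoothOfRelativeDimension_algebraMap n).mpr inferInstance
  have hcomp : chartRingHom k n d i j =
      E.toRingHom.comp (algebraMap (CoeffRing k n d) (S ⧸ Ideal.span {fS})) :=
    RingHom.ext fun r => rfl
  rw [hcomp]
  exact RingHom.isStandardSmoothOfRelativeDimension_respectsIso.1 _ E hQ

/-- **The chart of `𝒴` over `D₊(xᵢ ∂ⱼF)` is smooth of relative dimension `n` over `S^d = Spec R`.**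
[cite: Hartshorne1977, III Thm. 10.2] -/
theorem smoothOfRelativeDimension_subschemePiece (hd : 0 < d) :
    SmoothOfRelativeDimension n
      (ProjSubscheme.subschemePiece (idealSheaf k n d) (chartOpen k n d i j) ≫ totalToSpec k n d) := by
  rw [subschemePiece_hom, HasRingHomProperty.Spec_iff (P := @SmoothOfRelativeDimension n)]
  exact RingHom.locally_of RingHom.isStandardSmoothOfRelativeDimension_respectsIso _
    (isStandardSmoothOfRelativeDimension_chartRingHom k n d i j hd)

end Chart

/-! ### Smoothness of the family -/

/-- **The universal family of smooth hypersurfaces of degree `d ≥ 1` is smooth of relative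
dimension `n`** (Hartshorne III Thm. 10.2, Jacobian criterion in families; Voisin II, §6.2.1 "the
universal smooth hypersurface"): `𝒴_U` is covered by the restrictions of the charts over
`D₊(xᵢ ∂ⱼF)` (Euler cover), each smooth of relative dimension `n` over `S^d`.
[cite: Hartshorne1977, III Thm. 10.2] -/
theorem smoothOfRelativeDimension_familyHom (hd : 0 < d) :
    SmoothOfRelativeDimension n (familyHom k n d) := by
  set V := (totalToSpec k n d) ⁻¹ᵁ (baseOpens k n d) with hV
  let piece : ∀ ij : Fin (n + 2) × Fin (n + 1), _ := fun ij =>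
    ProjSubscheme.subschemePiece (idealSheaf k n d) (chartOpen k n d ij.1 ij.2)
  let 𝒱 : V.toScheme.OpenCover :=
    Scheme.Cover.mkOfCovers (Fin (n + 2) × Fin (n + 1))
      (fun ij => ((piece ij) ⁻¹ᵁ V).toScheme) (fun ij => piece ij ∣_ V)
      (fun x => by
        obtain ⟨hF, hns⟩ := exists_pderiv_not_mem k n d (V.ι x) x.2
        obtain ⟨ij, hij⟩ := exists_mem_basicOpen k n d (totalι k n d (V.ι x)) hF hns
        have hx : (V.ι x : totalSpace k n d) ∈ (piece ij).opensRange := by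
          rw [ProjSubscheme.opensRange_subschemePiece]
          exact hij
        obtain ⟨y, hy⟩ := hx
        have hyV : y ∈ (piece ij) ⁻¹ᵁ V := by
          change piece ij y ∈ V
          rw [hy]
          exact x.2
        refine ⟨ij, ⟨y, hyV⟩, ?_⟩
        apply Subtype.ext
        rw [morphismRestrict_base_coe]
        exact hy)
      (fun ij => IsZariskiLocalAtTarget.restrict (P := @IsOpenImmersion) inferInstance V)
  refine IsZariskiLocalAtSource.of_openCover (P := @SmoothOfRelativeDimension n) 𝒱 fun ij => ?_
  have h1 : SmoothOfRelativeDimension n ((piece ij ≫ totalToSpec k n d) ∣_ baseOpens k n d) :=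
    IsZariskiLocalAtTarget.restrict
      (smoothOfRelativeDimension_subschemePiece k n d ij.1 ij.2 hd) _
  rw [morphismRestrict_comp] at h1
  exact h1

/-- The same for the `k`-morphism `family k n d`. [cite: Hartshorne1977, III Thm. 10.2] -/
theorem smoothOfRelativeDimension_family_left (hd : 0 < d) :
    SmoothOfRelativeDimension n (family k n d).left :=
  smoothOfRelativeDimension_familyHom k n d hd

/-! ### Appendix: the degree-`d` piece of the Jacobian ideal (Voisin II, Remark 6.16) -/

section JacobianDegree

variable {K : Type u} [CommRing K] {σ : Type*}

/-- Homogeneous components of a product with a homogeneous factor: `(G · H)_{m+e} = G_m · H` for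
`H` homogeneous of degree `e`. [folklore] -/
theorem homogeneousComponent_mul_of_isHomogeneous {e : ℕ} (m : ℕ) (G H : MvPolynomial σ K)
    (hH : H.IsHomogeneous e) :
    homogeneousComponent (m + e) (G * H) = homogeneousComponent m G * H := by
  classical
  ext c
  rw [coeff_homogeneousComponent, coeff_mul, coeff_mul]
  by_cases hc : c.degree = m + e
  · rw [if_pos hc]
    refine Finset.sum_congr rfl fun p hp => ?_
    rw [coeff_homogeneousComponent]
    by_cases hb : coeff p.2 H = 0
    · rw [hb, mul_zero, mul_zero]
    · have hdb : p.2.degree = e := by rw [Finsupp.degree_eq_weight_one]; exact hH hb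
      have hsum : p.1 + p.2 = c := Finset.mem_antidiagonal.mp hp
      have hda : p.1.degree = m := by
        have := congrArg Finsupp.degree hsum
        rw [map_add, hdb, hc] at this
        omega
      rw [if_pos hda]
  · rw [if_neg hc]
    symm
    refine Finset.sum_eq_zero fun p hp => ?_
    rw [coeff_homogeneousComponent]
    by_cases hda : p.1.degree = m
    · rw [if_pos hda]
      by_cases hb : coeff p.2 H = 0
      · rw [hb, mul_zero]
      · exfalso
        apply hc
        have hsum : p.1 + p.2 = c := Finset.mem_antidiagonal.mp hp
        have hdb : p.2.degree = e := by rw [Finsupp.degree_eq_weight_one]; exact hH hb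
        rw [← hsum, map_add, hda, hdb]
    · rw [if_neg hda, zero_mul]

/-- A linear form is the sum of its coefficients times the variables. [folklore] -/
theorem eq_sum_C_mul_X_of_isHomogeneous_one [Fintype σ] (Q : MvPolynomial σ K)
    (hQ : Q.IsHomogeneous 1) : Q = ∑ j : σ, C (coeff (Finsupp.single j 1) Q) * X j := by
  classical
  ext m
  simp only [coeff_sum, coeff_C_mul, coeff_X, mul_ite, mul_one, mul_zero]
  by_cases hm : m.degree = 1
  · obtain ⟨j₀, rfl⟩ : m ∈ Set.range fun a : σ => Finsupp.single a 1 := by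
      rw [Finsupp.range_single_one]; exact hm
    rw [Finset.sum_eq_single j₀ (fun j _ hj => if_neg fun h => hj
      ((Finsupp.single_left_inj one_ne_zero).mp h)) (fun h => absurd (Finset.mem_univ _) h),
      if_pos rfl]
  · rw [hQ.coeff_eq_zero hm]
    symm
    refine Finset.sum_eq_zero fun j _ => if_neg fun h => hm ?_
    rw [← h, Finsupp.degree_single]

variable {N : ℕ}

/-- **The degree-`d` piece of the Jacobian ideal is the tangent space to the `GL`-orbit** (Voisin II,
Remark 6.16, "`T_{O_f,f} = J_f^d`"): for `F` homogeneous of degree `d ≥ 1`, every element of `J_F`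
which is homogeneous of degree `d` is an orbit tangent vector `Σᵢ Aᵢ ∂ᵢF` (write it as
`Σ Gᵢ ∂ᵢF` and keep the linear parts of the `Gᵢ`). Together with `orbitTangent_mem_jacobianIdeal`
and `isHomogeneous_orbitTangent`: `J_F^d = {orbitTangent F A}`. [cite: VoisinHodgeII2003, Remark 6.16] -/
theorem exists_orbitTangent_eq {d : ℕ} (hd : 1 ≤ d) (F : MvPolynomial (Fin (N + 1)) K)
    (hF : F.IsHomogeneous d) {P : MvPolynomial (Fin (N + 1)) K} (hP : P ∈ jacobianIdeal F)
    (hPd : P.IsHomogeneous d) :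
    ∃ A : Matrix (Fin (N + 1)) (Fin (N + 1)) K, orbitTangent F A = P := by
  classical
  obtain ⟨c, hc⟩ := Ideal.mem_span_range_iff_exists_fun.mp hP
  refine ⟨fun i j => coeff (Finsupp.single j 1) (homogeneousComponent 1 (c i)), ?_⟩
  have hde : 1 + (d - 1) = d := by omega
  have key : P = ∑ i, homogeneousComponent 1 (c i) * pderiv i F := by
    have h1 : homogeneousComponent d P = P := by
      rw [homogeneousComponent_of_mem hPd, if_pos rfl]
    rw [← h1, ← hc, map_sum]
    refine Finset.sum_congr rfl fun i _ => ?_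
    rw [← hde, homogeneousComponent_mul_of_isHomogeneous 1 (c i) _ hF.pderiv]
  rw [key, orbitTangent]
  refine Finset.sum_congr rfl fun i _ => ?_
  rw [← eq_sum_C_mul_X_of_isHomogeneous_one _ (homogeneousComponent_isHomogeneous 1 (c i))]

end JacobianDegree

end Literature.AlgebraicGeometry.Motives.UniversalHypersurface

end
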